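import Summits.Ventures.YMGap.RobustBall.IsingBallD3Embed
import Summits.Ventures.YMGap.RobustBall.IsingBallD3Bound
import Summits.Ventures.YMGap.RobustBall.IsingBallB2Layer
import HarnessLib

/-!
# RobustBall/IsingBallD3Layer — the rung-3 certificate of the balls `B₂(a)` in the two-dimensional layers of `(ℤ/L)^3` and the two-point bound
# `⟨σ_b σ_t⟩ ≤ φ₃^{⌊dist_j/3⌋}`, `φ₃ = 0.996998…`, for the layer Ising model at every coupling `0 ≤ β ≤ artanh(6/19)`

HONEST FRAMING: venture file of the cell `pub-ymgap` (QuantumFields programme), track Y2 ROBUST-BALL / DS seat ds-4 (g10); the `d = 3` twin of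
`IsingBallB2Layer`.  Finite statements about the free-boundary Ising model on `layerGraph i H` of the torus `(ℤ/L)^3`; nothing about `SU(2)` here.

WHAT.  With the induced copy `B₂(a) = ballSet` (`IsingBallD3Embed`): an axis site has `≤ 3` and a corner `≤ 2` layer-neighbours outside the ball, the
centre and the middle sites none; hence the Simon–Lieb certificate of `B₂(a)` is `≤ tanh β₁ · B` whenever the boundary sum `3∑_axis + 2∑_corner` of
`BallD3.graph` is `≤ B` on `[0, β₁]` (`ball_certificate_le_of`), and gen 9's LADDER ENGINE gives **`isingTwoPoint_layer_le_pow_of`** /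
**`isingTwoPoint_layer_le_rate3_pow`**: `⟨σ_b σ_t⟩^∅_{univ;β} ≤ φ₃^{⌊dist_j(t,b)/3⌋}` for `L ≥ 6`, every `H`, `0 ≤ β ≤ β₃ = artanh(6/19)`
(`φ₃ = rate3 = 0.996998…`; rung 2 needed `12 tanh²β < 1`, i.e. `β < 0.29706`; rung 3 holds up to `0.32696`).

References: B. Simon, Comm. Math. Phys. 77 (1980) 111; E. Lieb, Comm. Math. Phys. 77 (1980) 127; H. Duminil-Copin, V. Tassion, Comm. Math. Phys. 343
(2016) 725, Lemma 2.7.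
-/

noncomputable section

open Finset
open Literature.Probability.LatticeModels
open Literature.MathematicalPhysics.QuantumFieldTheory

namespace Summit.Ventures.YMGap.RobustBall

namespace BallD3

open V ZN ZTwo

variable {L : ℕ} [NeZero L]

/-! ### Layer-neighbours outside the ball -/

/-- The exit set avoids a given set `T` of neighbours INSIDE the ball, so it has `≤ 4 − |T|` elements (degree `≤ 4`). [folklore] -/
theorem card_exitSet_le (hL : 6 ≤ L) (i : Fin 3) (H : Finset (ZMod L)) (a x : Site 3 L) (T : Finset (Site 3 L))
    (hT : T ⊆ (layerGraph i H).neighborFinset x ∩ ballSet hL i a) : (((univ \ ballSet hL i a).filter ((layerGraph i H).Adj x))).card + T.card ≤ 4 := by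
  have hsub : ((univ \ ballSet hL i a).filter ((layerGraph i H).Adj x)) ⊆ (layerGraph i H).neighborFinset x \ T := by
    intro y hy
    rw [mem_filter, mem_sdiff] at hy
    rw [mem_sdiff, SimpleGraph.mem_neighborFinset]
    exact ⟨hy.2, fun hyT => hy.1.2 (mem_inter.1 (hT hyT)).2⟩
  have h1 := card_le_card hsub
  rw [card_sdiff_of_subset (hT.trans inter_subset_left)] at h1
  have h2 := card_neighborFinset_layerGraph_le i H x
  have h3 : T.card ≤ ((layerGraph i H).neighborFinset x).card := card_le_card (hT.trans inter_subset_left)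
  omega

/-- **An axis site has at most `3` layer-neighbours outside the ball**. [folklore] -/
theorem card_exitSet_axis_le (hL : 6 ≤ L) {i : Fin 3} {H : Finset (ZMod L)} {a : Site 3 L} (ha : a i ∈ H) (k : Fin 2) (s : Bool) :
    (((univ \ ballSet hL i a).filter ((layerGraph i H).Adj (ballEmb i a (axis k s))))).card ≤ 3 := by
  have h := card_exitSet_le hL i H a (ballEmb i a (axis k s)) {ballEmb i a (mid k s)} (by
    rw [singleton_subset_iff, mem_inter, SimpleGraph.mem_neighborFinset, layerGraph_adj_ballEmb_iff hL ha]
    exact ⟨by simp [graph_adj, V.adj], ballEmb_mem_ballSet hL i a _⟩)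
  rw [card_singleton] at h
  omega

/-- **A corner has at most `2` layer-neighbours outside the ball**. [folklore] -/
theorem card_exitSet_corner_le (hL : 6 ≤ L) {i : Fin 3} {H : Finset (ZMod L)} {a : Site 3 L} (ha : a i ∈ H) (s s' : Bool) :
    (((univ \ ballSet hL i a).filter ((layerGraph i H).Adj (ballEmb i a (corner s s'))))).card ≤ 2 := by
  have hne : ballEmb i a (mid 0 s) ≠ ballEmb i a (mid 1 s') := fun h => mid_zero_ne_mid_one s s' (ballEmb_injective hL i a h)
  have h := card_exitSet_le hL i H a (ballEmb i a (corner s s')) {ballEmb i a (mid 0 s), ballEmb i a (mid 1 s')} (by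
    intro y hy
    rw [mem_insert, mem_singleton] at hy
    rw [mem_inter, SimpleGraph.mem_neighborFinset]
    rcases hy with rfl | rfl
    · exact ⟨(layerGraph_adj_ballEmb_iff hL ha _ _).2 (by simp [graph_adj, V.adj]), ballEmb_mem_ballSet hL i a _⟩
    · exact ⟨(layerGraph_adj_ballEmb_iff hL ha _ _).2 (by simp [graph_adj, V.adj]), ballEmb_mem_ballSet hL i a _⟩)
  rw [card_pair hne] at h
  omega

/-- **The centre and the middle sites have NO layer-neighbours outside the ball**. [folklore] -/
theorem exitSet_eq_empty_of_inner (hL : 6 ≤ L) {i : Fin 3} {H : Finset (ZMod L)} {a : Site 3 L} (p : V)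
    (hp : p = centre ∨ ∃ k' s', p = mid k' s') : ((univ \ ballSet hL i a).filter ((layerGraph i H).Adj (ballEmb i a p))) = ∅ := by
  refine eq_empty_of_forall_notMem fun y hy => ?_
  rw [mem_filter, mem_sdiff] at hy
  obtain ⟨⟨-, hyS⟩, hadj⟩ := hy
  obtain ⟨v, hv, ε, hε, rfl⟩ := exists_single_of_adj hadj
  obtain ⟨k, rfl⟩ := Fin.exists_succAbove_eq hv
  obtain ⟨e, he, rfl⟩ := exists_int_cast_of_sign hε
  obtain ⟨⟨q₁, hq₁⟩, ⟨q₂, hq₂⟩⟩ := exists_of_inner_step p k hp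
  apply hyS
  rcases he with rfl | rfl
  · have : ballEmb i a q₁ = ballEmb i a p + Pi.single (i.succAbove k) (((1 : ℤ) : ℤ) : ZMod L) := by
      unfold ballEmb; rw [hq₁, map_add, offHom_single, add_assoc]
    rw [← this]; exact ballEmb_mem_ballSet hL i a _
  · have : ballEmb i a q₂ = ballEmb i a p + Pi.single (i.succAbove k) (((-1 : ℤ) : ℤ) : ZMod L) := by
      unfold ballEmb; rw [hq₂, map_add, offHom_single, add_assoc]
    rw [← this]; exact ballEmb_mem_ballSet hL i a _

/-! ### The certificate of the balls and the two-point bound -/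

/-- A sum over the ball sites, by type. [folklore] -/
theorem sum_V (g : V → ℝ) :
    ∑ p : V, g p = g centre + ∑ ks : Fin 2 × Bool, g (mid ks.1 ks.2) + ∑ ks : Fin 2 × Bool, g (axis ks.1 ks.2) + ∑ c : Bool × Bool, g (corner c.1 c.2) := by
  rw [← equivSum.symm.sum_comp]
  simp only [Fintype.sum_sum_type, Fintype.sum_unique, ← add_assoc]
  rfl

/-- **THE CERTIFICATE OF `B₂(a)` FROM A BOUNDARY-SUM BOUND** (`d = 3`, `L ≥ 6`, `a` at a selected height): if `3∑_axis + 2∑_corner ≤ B` on `[0, β₁]`,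
then `φ_β(B₂(a)) ≤ tanh β₁ · B` for `0 ≤ β ≤ β₁`. [cite: DuminilCopinTassionCMP2016, Lemma 2.7] -/
theorem ball_certificate_le_of (hL : 6 ≤ L) {β₁ B : ℝ}
    (hB : ∀ β : ℝ, 0 ≤ β → β ≤ β₁ →
      3 * ∑ ks : Fin 2 × Bool, isingTwoPoint graph univ β 0 .free centre (axis ks.1 ks.2) +
        2 * ∑ c : Bool × Bool, isingTwoPoint graph univ β 0 .free centre (corner c.1 c.2) ≤ B)
    {β : ℝ} (h0 : 0 ≤ β) (hβ : β ≤ β₁) {i : Fin 3} (H : Finset (ZMod L)) {a : Site 3 L} (ha : a i ∈ H) :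
    ∑ x ∈ ballSet hL i a, ∑ _y ∈ (univ \ ballSet hL i a).filter ((layerGraph i H).Adj x),
        Real.tanh β * isingTwoPoint (layerGraph i H) (ballSet hL i a) β 0 .free a x ≤ Real.tanh β₁ * B := by
  have ht0 : 0 ≤ Real.tanh β := by simpa using Literature.Probability.LatticeModels.tanh_le_tanh h0
  have ht1 : Real.tanh β ≤ Real.tanh β₁ := Literature.Probability.LatticeModels.tanh_le_tanh hβ
  have hrw : ∑ x ∈ ballSet hL i a, ∑ _y ∈ (univ \ ballSet hL i a).filter ((layerGraph i H).Adj x),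
        Real.tanh β * isingTwoPoint (layerGraph i H) (ballSet hL i a) β 0 .free a x =
      ∑ p : V, ((((univ \ ballSet hL i a).filter ((layerGraph i H).Adj (ballEmb i a p)))).card : ℝ) * (Real.tanh β * isingTwoPoint graph univ β 0 .free centre p) := by
    rw [ballSet, sum_map]
    refine sum_congr rfl fun p _ => ?_
    rw [sum_const, nsmul_eq_mul, ← isingTwoPoint_ballSet_eq hL ha β centre p, ballEmb_centre]
    rfl
  rw [hrw, sum_V]
  have hG0 : ∀ p, 0 ≤ Real.tanh β * isingTwoPoint graph univ β 0 .free centre p := fun p =>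
    mul_nonneg ht0 (DCPLower.isingTwoPoint_free_nonneg_of_mem graph h0 (mem_univ _) (mem_univ _))
  rw [exitSet_eq_empty_of_inner hL centre (Or.inl rfl)]
  simp only [card_empty, Nat.cast_zero, zero_mul, zero_add]
  have hmid : ∑ ks : Fin 2 × Bool, ((((univ \ ballSet hL i a).filter ((layerGraph i H).Adj (ballEmb i a (mid ks.1 ks.2))))).card : ℝ) *
      (Real.tanh β * isingTwoPoint graph univ β 0 .free centre (mid ks.1 ks.2)) = 0 :=
    sum_eq_zero fun ks _ => by rw [exitSet_eq_empty_of_inner hL (mid ks.1 ks.2) (Or.inr ⟨ks.1, ks.2, rfl⟩)]; simp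
  have haxis : ∑ ks : Fin 2 × Bool, ((((univ \ ballSet hL i a).filter ((layerGraph i H).Adj (ballEmb i a (axis ks.1 ks.2))))).card : ℝ) *
      (Real.tanh β * isingTwoPoint graph univ β 0 .free centre (axis ks.1 ks.2)) ≤
      ∑ ks : Fin 2 × Bool, 3 * (Real.tanh β * isingTwoPoint graph univ β 0 .free centre (axis ks.1 ks.2)) :=
    sum_le_sum fun ks _ => mul_le_mul_of_nonneg_right (by exact_mod_cast card_exitSet_axis_le hL ha ks.1 ks.2) (hG0 _)
  have hcorner : ∑ c : Bool × Bool, ((((univ \ ballSet hL i a).filter ((layerGraph i H).Adj (ballEmb i a (corner c.1 c.2))))).card : ℝ) *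
      (Real.tanh β * isingTwoPoint graph univ β 0 .free centre (corner c.1 c.2)) ≤
      ∑ c : Bool × Bool, 2 * (Real.tanh β * isingTwoPoint graph univ β 0 .free centre (corner c.1 c.2)) :=
    sum_le_sum fun c _ => mul_le_mul_of_nonneg_right (by exact_mod_cast card_exitSet_corner_le hL ha c.1 c.2) (hG0 _)
  have hBβ := hB β h0 hβ
  have hB0 : 0 ≤ 3 * ∑ ks : Fin 2 × Bool, isingTwoPoint graph univ β 0 .free centre (axis ks.1 ks.2) +
      2 * ∑ c : Bool × Bool, isingTwoPoint graph univ β 0 .free centre (corner c.1 c.2) :=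
    add_nonneg (mul_nonneg (by norm_num) (sum_nonneg fun _ _ => DCPLower.isingTwoPoint_free_nonneg_of_mem graph h0 (mem_univ _) (mem_univ _)))
      (mul_nonneg (by norm_num) (sum_nonneg fun _ _ => DCPLower.isingTwoPoint_free_nonneg_of_mem graph h0 (mem_univ _) (mem_univ _)))
  calc ∑ ks : Fin 2 × Bool, ((((univ \ ballSet hL i a).filter ((layerGraph i H).Adj (ballEmb i a (mid ks.1 ks.2))))).card : ℝ) *
          (Real.tanh β * isingTwoPoint graph univ β 0 .free centre (mid ks.1 ks.2)) +
        ∑ ks : Fin 2 × Bool, ((((univ \ ballSet hL i a).filter ((layerGraph i H).Adj (ballEmb i a (axis ks.1 ks.2))))).card : ℝ) *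
          (Real.tanh β * isingTwoPoint graph univ β 0 .free centre (axis ks.1 ks.2)) +
        ∑ c : Bool × Bool, ((((univ \ ballSet hL i a).filter ((layerGraph i H).Adj (ballEmb i a (corner c.1 c.2))))).card : ℝ) *
          (Real.tanh β * isingTwoPoint graph univ β 0 .free centre (corner c.1 c.2))
      ≤ 0 + ∑ ks : Fin 2 × Bool, 3 * (Real.tanh β * isingTwoPoint graph univ β 0 .free centre (axis ks.1 ks.2)) +
        ∑ c : Bool × Bool, 2 * (Real.tanh β * isingTwoPoint graph univ β 0 .free centre (corner c.1 c.2)) := by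
        rw [hmid]; gcongr
    _ = Real.tanh β * (3 * ∑ ks : Fin 2 × Bool, isingTwoPoint graph univ β 0 .free centre (axis ks.1 ks.2) +
        2 * ∑ c : Bool × Bool, isingTwoPoint graph univ β 0 .free centre (corner c.1 c.2)) := by
        rw [mul_sum, mul_sum, mul_add, mul_sum, mul_sum, zero_add]
        congr 1 <;> refine sum_congr rfl fun _ _ => ?_ <;> ring
    _ ≤ Real.tanh β₁ * B := mul_le_mul ht1 hBβ hB0 (ht0.trans ht1)

/-- **TWO-POINT BOUND OF THE LAYER ISING MODEL FROM A BOUNDARY-SUM BOUND** (`d = 3`, `L ≥ 6`): if `3∑_axis + 2∑_corner ≤ B` on `[0, β₁]`, then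
`⟨σ_b σ_t⟩^∅_{univ;β} ≤ (tanh β₁ · B)^{⌊dist_j(t,b)/3⌋}` on `layerGraph i H` for every `H`, `0 ≤ β ≤ β₁`. [cite: DuminilCopinTassionCMP2016, Lemma 2.7] -/
theorem isingTwoPoint_layer_le_pow_of (hL : 6 ≤ L) {β₁ B : ℝ}
    (hB : ∀ β : ℝ, 0 ≤ β → β ≤ β₁ →
      3 * ∑ ks : Fin 2 × Bool, isingTwoPoint graph univ β 0 .free centre (axis ks.1 ks.2) +
        2 * ∑ c : Bool × Bool, isingTwoPoint graph univ β 0 .free centre (corner c.1 c.2) ≤ B)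
    {β : ℝ} (h0 : 0 ≤ β) (hβ : β ≤ β₁) (i j : Fin 3) (H : Finset (ZMod L)) (t b : Site 3 L) :
    isingTwoPoint (layerGraph i H) univ β 0 .free b t ≤ (Real.tanh β₁ * B) ^ (jDist j t b / 3) := by
  classical
  have hφ0 : 0 ≤ Real.tanh β₁ * B := by
    have ht1 : 0 ≤ Real.tanh β₁ := by simpa using Literature.Probability.LatticeModels.tanh_le_tanh (h0.trans hβ)
    refine mul_nonneg ht1 ((add_nonneg (mul_nonneg (by norm_num) (sum_nonneg fun _ _ => ?_))
      (mul_nonneg (by norm_num) (sum_nonneg fun _ _ => ?_))).trans (hB β h0 hβ))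
    · exact DCPLower.isingTwoPoint_free_nonneg_of_mem graph h0 (mem_univ _) (mem_univ _)
    · exact DCPLower.isingTwoPoint_free_nonneg_of_mem graph h0 (mem_univ _) (mem_univ _)
  refine IsingStar.isingTwoPoint_free_le_pow_of_certificate (layerGraph i H) h0
    (S := fun a => if a i ∈ H then ballSet hL i a else {a}) 2 (fun a _ => subset_univ _) (fun a _ => ?_) (jDist j t)
    (fun a _ x hx => ?_) (fun y y' h => jDist_le_of_adj j t h) (jDist_self j t) (mem_univ t) (fun a _ => ?_)
    (jDist j t b / 3) b (mem_univ b) (by omega)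
  · by_cases ha : a i ∈ H
    · simp only [ha, if_true]; exact mem_ballSet_self hL i a
    · simp only [ha, if_false]; exact mem_singleton_self a
  · by_cases ha : a i ∈ H
    · simp only [ha, if_true, ballSet, mem_map] at hx
      obtain ⟨p, -, rfl⟩ := hx
      exact jDist_ballEmb_le j t i a p
    · simp only [ha, if_false, mem_singleton] at hx
      subst hx; omega
  · by_cases ha : a i ∈ H
    · simp only [ha, if_true]
      exact ball_certificate_le_of hL hB h0 hβ H ha
    · simp only [ha, if_false, sum_singleton]
      have hempty : (univ \ {a}).filter ((layerGraph i H).Adj a) = ∅ :=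
        eq_empty_of_forall_notMem fun y hy => ha (height_mem_of_adj (mem_filter.1 hy).2)
      rw [hempty, sum_empty]
      exact hφ0

/-- **RUNG 3 (`d = 3`) AT `β₃ = artanh(6/19)`**: `⟨σ_b σ_t⟩^∅_{univ;β} ≤ φ₃^{⌊dist_j(t,b)/3⌋}`, `φ₃ = rate3 = 0.996998…`, for `L ≥ 6`, every `H`,
`0 ≤ β ≤ β₃`. [cite: DuminilCopinTassionCMP2016, Lemma 2.7] -/
theorem isingTwoPoint_layer_le_rate3_pow (hL : 6 ≤ L) {β : ℝ} (h0 : 0 ≤ β) (hβ : β ≤ beta3) (i j : Fin 3) (H : Finset (ZMod L))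
    (t b : Site 3 L) : isingTwoPoint (layerGraph i H) univ β 0 .free b t ≤ rate3 ^ (jDist j t b / 3) := by
  have h := isingTwoPoint_layer_le_pow_of hL (fun β h0 hβ => boundarySum_le h0 hβ) h0 hβ i j H t b
  rwa [tanh_beta3] at h

end BallD3

end Summit.Ventures.YMGap.RobustBall

end
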